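import Summits.QuantumFields.YangMills.Theorems.BalabanLadderUVSeamRecCeilingsResponseMoments
import Summits.QuantumFields.YangMills.Theorems.BalabanLadderUVSeamRecCeilingsTransfer
import HarnessLib

/-!
# Crux `UVSeamRec` (stmt-QuantumFields-20043), stub `stub_ceilings` (E0′): the response-moment input (RM) at ANY unit
# eventually coarser-bounded by the unit of record gives the REGISTERED conclusion `MomentBounds6 SU(2) rF uRec`

Helper file (`--supports stmt-QuantumFields-20043`) of the width-lever seat `ym-20043-ceilings-p2` (lane B); a LEAF of the
theses cone (it imports the lead's `…CeilingsTransfer`, p442252, for `momentBounds6_of_eventually_le`).  Sequel of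
p532025 `…CeilingsResponseMoments.lean` (`momentBounds6_of_responseMoments : (RM) → MomentBounds6 G r a`).  HONEST
FRAMING: composition only; (RM) and the flow window are OPEN inputs; nothing of E0′ is claimed; not a gap, not Clay.

* `momentBounds6_of_responseMoments_eventually` — (RM) at unit `a` (reference values `p`, constants `C₁ > 0`, `B`,
  `ℓ₁ > 0`, `β₁`) and `a ≤ c·u` eventually (`c > 0`) ⇒ `MomentBounds6 G r u` (general `G`, `r`).
* **`stubCeilings_of_responseMoments`** — the v5 press-button recommended by this seat's note (rev 2 §6, evidence #55; OWNER
  R86f moved the v5 stub texts to the response currency): for `SU(2)` in the fundamental representation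
  `rF := fundamentalLatticeRep 2`, (RM) at some unit `a` with `a ≤ c · uRec` eventually ⇒ the conclusion of the
  registered `stub_ceilings` VERBATIM (`MomentBounds6 (SU(2)) rF Transport.uRec` under the Borel structure).  So a v5
  skeleton with ONE non-fed stub `stub_responseMomentsOdd6 : UV → ∃ a c, 0 < c ∧ (∀ᶠ β, a β ≤ c·uRec β) ∧ (RM at a)` closes
  `stub_ceilings` by `exact stubCeilings_of_responseMoments (stub_responseMomentsOdd6 hUV)`.

References: as p530862/p532025 (Georgii (2011) Thm. 4.17 for the DLR step).
-/

set_option autoImplicit false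

noncomputable section

open MeasureTheory Filter Topology Finset
open Literature.MathematicalPhysics.QuantumFieldTheory (LatticeRep)
open Literature.MathematicalPhysics.QuantumLattice

namespace Summit.QuantumFields.YangMills.Cruxes.UVSeamRec.TemperedResponse

open Summit.QuantumFields.YangMills.Cruxes.OSLegsFromFemtoAndGap.DlrCollarTransfer
open Summit.QuantumFields.YangMills.Cruxes.UVSeamRec.CeilingsTransfer (momentBounds6_of_eventually_le)

section Unit

variable {G : Type} [Group G] [TopologicalSpace G] [IsTopologicalGroup G] [CompactSpace G]
  [MeasurableSpace G] [BorelSpace G]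

/-- **(RM) at an eventually coarser-bounded unit gives the ceilings at the target unit.**  (RM) at unit `a` — joint
exponential moments `⟨exp(Σ_{i∈T} (R⁴/C₁)|kerE_{cube i}(plane_i) − p_i|)⟩_{2L+1,β} ≤ exp(B·#T)` for `β ≥ β₁`, `1 ≤ R`,
`R·a β ≤ ℓ₁`, `4R+8 ≤ L`, cyclically separated sites — and `a β ≤ c·u β` eventually (`c > 0`) ⇒ `MomentBounds6 G r u`.
Proof: p532025 ⊕ the lead's one-sided unit transfer p442252. [folklore] -/
theorem momentBounds6_of_responseMoments_eventually (r : LatticeRep G) {a u : ℝ → ℝ} {c : ℝ} (hc : 0 < c)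
    (hle : ∀ᶠ β in atTop, a β ≤ c * u β) {C₁ B β₁ ℓ₁ P₀ : ℝ} {p : Fin 4 × Fin 4 → ℝ → ℝ}
    (hℓ₁ : 0 < ℓ₁) (hC₁ : 0 < C₁) (hp : ∀ q β, |p q β| ≤ P₀)
    (hRM : ∀ β : ℝ, β₁ ≤ β → ∀ (L n : ℕ) (q : Fin n → Fin 4 × Fin 4) (x : Fin n → (Fin 4 → ℤ)) (R : ℕ),
      (∀ i, (q i).1 < (q i).2) → 1 ≤ R → (R : ℝ) * a β ≤ ℓ₁ → 4 * R + 8 ≤ L →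
      (∀ i j : Fin n, i ≠ j → ∃ k : Fin 4,
        (2 * (R : ℤ) + 4) ≤ |((((x i k - x j k : ℤ) : ZMod (2 * L + 1))).valMinAbs : ℤ)|) →
      ∀ T : Finset (Fin n),
        torusE G r β L (fun U => Real.exp (∑ i ∈ T, (R : ℝ) ^ 4 / C₁ *
          |kerE G r β (fun k => x i k - (R + 1)) (2 * R + 3) U (plane G r (q i) (x i)) - p (q i) β|)) ≤
          Real.exp (B * T.card)) :
    MomentBounds6 G r u :=
  momentBounds6_of_eventually_le r hc hle (momentBounds6_of_responseMoments r a hℓ₁ hC₁ hp hRM)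

end Unit

/-! ## The press-button at the unit of record for `SU(2)` in the fundamental representation -/

section PressButton

/-- **The registered `stub_ceilings` conclusion from the response-moment input.**  For `SU(2)` (Borel structure) in the
fundamental lattice representation `rF := fundamentalLatticeRep 2`: if there are a unit `a` and `c > 0` with
`a β ≤ c · uRec β` eventually and (RM) at unit `a` (reference values `p`, constants `C₁ > 0`, `B`, `ℓ₁ > 0`, `β₁`), then
`MomentBounds6 (SU(2)) rF uRec` — the conclusion of v4-F's `stub_ceilings` verbatim.  This is the composition the v5
skeleton of record should use if the owner registers ONE non-fed stub `UV → ∃ a c, … ∧ (RM at a)` (this seat's note rev 2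
§6; OWNER R86f). [folklore] -/
theorem stubCeilings_of_responseMoments
    (h : letI : MeasurableSpace (Matrix.specialUnitaryGroup (Fin 2) ℂ) := borel _
      haveI : BorelSpace (Matrix.specialUnitaryGroup (Fin 2) ℂ) := ⟨rfl⟩
      ∃ (a : ℝ → ℝ) (c : ℝ) (C₁ B β₁ ℓ₁ P₀ : ℝ) (p : Fin 4 × Fin 4 → ℝ → ℝ), 0 < c ∧
        (∀ᶠ β in atTop, a β ≤ c * Transport.uRec β) ∧ 0 < ℓ₁ ∧ 0 < C₁ ∧ (∀ q β, |p q β| ≤ P₀) ∧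
        ∀ β : ℝ, β₁ ≤ β → ∀ (L n : ℕ) (q : Fin n → Fin 4 × Fin 4) (x : Fin n → (Fin 4 → ℤ)) (R : ℕ),
          (∀ i, (q i).1 < (q i).2) → 1 ≤ R → (R : ℝ) * a β ≤ ℓ₁ → 4 * R + 8 ≤ L →
          (∀ i j : Fin n, i ≠ j → ∃ k : Fin 4,
            (2 * (R : ℤ) + 4) ≤ |((((x i k - x j k : ℤ) : ZMod (2 * L + 1))).valMinAbs : ℤ)|) →
          ∀ T : Finset (Fin n),
            torusE (Matrix.specialUnitaryGroup (Fin 2) ℂ) (fundamentalLatticeRep 2) β L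
              (fun U => Real.exp (∑ i ∈ T, (R : ℝ) ^ 4 / C₁ *
                |kerE (Matrix.specialUnitaryGroup (Fin 2) ℂ) (fundamentalLatticeRep 2) β
                  (fun k => x i k - (R + 1)) (2 * R + 3) U
                  (plane (Matrix.specialUnitaryGroup (Fin 2) ℂ) (fundamentalLatticeRep 2) (q i) (x i)) -
                  p (q i) β|)) ≤ Real.exp (B * T.card)) :
    letI : MeasurableSpace (Matrix.specialUnitaryGroup (Fin 2) ℂ) := borel _
    haveI : BorelSpace (Matrix.specialUnitaryGroup (Fin 2) ℂ) := ⟨rfl⟩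
    MomentBounds6 (Matrix.specialUnitaryGroup (Fin 2) ℂ) (fundamentalLatticeRep 2) Transport.uRec := by
  letI : MeasurableSpace (Matrix.specialUnitaryGroup (Fin 2) ℂ) := borel _
  haveI : BorelSpace (Matrix.specialUnitaryGroup (Fin 2) ℂ) := ⟨rfl⟩
  obtain ⟨a, c, C₁, B, β₁, ℓ₁, P₀, p, hc, hle, hℓ₁, hC₁, hp, hRM⟩ := h
  exact momentBounds6_of_responseMoments_eventually (fundamentalLatticeRep 2) hc hle hℓ₁ hC₁ hp hRM

end PressButton

end Summit.QuantumFields.YangMills.Cruxes.UVSeamRec.TemperedResponse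

end
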